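import Mathlib
import Summits.NavierStokesRegularity.NavierStokesRegularity.Theorems.UnthreadedDoorNetFluxDefs
import Summits.NavierStokesRegularity.NavierStokesRegularity.Theorems.UnthreadedDoorNetFluxViscosityDefs
import Summits.NavierStokesRegularity.NavierStokesRegularity.Theorems.UnthreadedDoorNetFluxEnvelopeDefs
import Summits.NavierStokesRegularity.NavierStokesRegularity.Theorems.UnthreadedDoorNetFluxStratumLiouville
import Summits.NavierStokesRegularity.NavierStokesRegularity.Theorems.UnthreadedDoorNetFluxNF1aExtremalHeadEMFOfLevelLip
import Summits.NavierStokesRegularity.NavierStokesRegularity.Theorems.UnthreadedDoorNetFluxNSSpatialAnalyticity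
import Summits.NavierStokesRegularity.NavierStokesRegularity.Theorems.UnthreadedDoorNetFluxNF1aExtremalHeadEMFIoo
import Summits.NavierStokesRegularity.NavierStokesRegularity.Theorems.UnthreadedDoorNetFluxCumulativeFluxLipschitz
import Summits.NavierStokesRegularity.NavierStokesRegularity.Theorems.UnthreadedDoorNetFluxOneSidedLawOffNull
import Summits.NavierStokesRegularity.NavierStokesRegularity.Theorems.UnthreadedDoorNetFluxHalfLineOUOffNull
import Summits.NavierStokesRegularity.NavierStokesRegularity.Theorems.UnthreadedDoorNetFluxRhoLipschitz
import Summits.NavierStokesRegularity.NavierStokesRegularity.Theorems.UnthreadedDoorNetFluxNullTimeGaugeTransfer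
import Summits.NavierStokesRegularity.NavierStokesRegularity.Theorems.UnthreadedDoorNetFluxWindowDecayOffNull
import Summits.NavierStokesRegularity.NavierStokesRegularity.Theorems.UnthreadedDoorNetFluxNullTimeDenseFiniteZeroScalarLiouville
import Summits.NavierStokesRegularity.NavierStokesRegularity.Cruxes.PoloidalLiouville.NetFluxTransportSketch
import Literature.Analysis.FluidPDE.HalfLineOUViscosity

/-!
# Crux `PoloidalLiouville` (stmt-NavierStokesRegularity-1222), WALL W1 `stub_scalarLiouville` — crux idea «null-time»
# (ns-idea-14 g5, lens «strengthen», 2026-08-29): **time-isolated vortex-null sheets are removable**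

TYPED SKETCH v1.3 (2026-08-29T02:35Z, custodian ns-idea-14 g6; v1.2 = crux write 0dd9c4b44e10, v1.1 = 610e50e5126d, v1.0 = 48799f88a96d) — SORRY-FREE.
v1.3 WIRING: AE-4′ `stub_windowDecayOffNull` := p688382 `NetFlux.netFluxWindowDecayOffNull` (ARM A g5, UNCONDITIONAL; the three hypotheses of the
stub are discarded) ⇒ `nullTimeDenseFinite_of_stubs` (K3ᵃᵉ) has NO sorry; and K3ᵃᵉ is ALSO a Theorems-side theorem BY NAME: p688761
`NetFlux.nullTimeDenseFiniteZeroScalarLiouvilleTypeI_holds` (wired below as `k3ae_holds`).  The «null-time» chain is fully discharged; the Type-I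
residual of W1 is `PersistentSheetResidualTypeI` (named Theorems-side in `…NetFluxNullTimeDefs`, ARM A KEY (1)); the next stratum is the «cell-flux»
sketch `Cruxes/PoloidalLiouville/CellFluxSketch.lean` (aa4d27c16881).  ⟨1222⟩ / W1 / NS regularity remain OPEN.
v1.2 WIRING (one pass, nothing restated): AE-1 `stub_oneSidedLawOffNull` := p686638 `NetFlux.oneSidedLawOffNull` (qj-p1); AE-2′ RE-TYPED to
`HalfLineOUDecayOffNullClosed` (= v1.1 `HalfLineOUDecayOffNull` with `IsClosed D →` inserted and the `U₁` clause (iii) deleted — ARM A g5 design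
01:29Z, critic V19-P1 ruling 01:54Z) and CLOSED BY NAME := p687414 `NetFlux.halfLineOU_decay_viscosity_offNull` (ARM A; deps p686271 null-time
barrier, p686981 lemmas); AE-3b `stub_netFluxRhoLipschitz` := p687228 `NetFlux.netFluxRhoLipschitz` (qj-p1; now an ASIDE — AE-4′ no longer consumes
it); AE-6 `stub_nullTimeDenseFinite_of_analytic` := p687507 `NetFlux.nullTimeDenseFinite_of_analytic` (qj-p1); AE-4′ `stub_windowDecayOffNull`
RE-TYPED `OneSidedLawOffNull → HalfLineOUDecayOffNullClosed → CumulativeFluxLipschitz → NetFluxWindowDecayOffNull` — the ONE remaining `sorry`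
(ARM A g5 claimed it 01:54Z: `Theorems/UnthreadedDoorNetFluxWindowDecayOffNull.lean`, re-run of p669139/p678535 with the off-null comparison).
The v1.1 Prop `HalfLineOUDecayOffNull` (D merely null, extra `U₁` clause, mollification route) stays as an unregistered ASIDE with no stub.  Companion of the registered LINE
`Cruxes/PoloidalLiouville/Lines/height_head.lean` (K3ᶠ `DenseFiniteZeroScalarLiouvilleTypeI`: Type-I scalar Liouville when, at EVERY
time `t < 0`, the radii whose sphere carries finitely many vorticity zeros are dense).  K3ᶠ's residual `NullSheetResidualTypeI` asks for a
vortex-null SHEET at SOME time.  This sketch types the STRENGTHENING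

  **K3ᵃᵉ `NullTimeDenseFiniteZeroScalarLiouvilleTypeI`**: the same conclusion when the dense-finite-zero condition holds for every
  `t < 0` OUTSIDE a closed Lebesgue-null set `D` of times,

and its kernel-checked consequences: K3ᵃᵉ ⇒ K3ᶠ (`denseFinite_of_nullTime`, `D = ∅`) and K3ᵃᵉ ∧ `PersistentSheetResidualTypeI` ⇒
`NullSheetResidualTypeI` (`nullSheetResidual_of_nullTime`), so that after K3ᵃᵉ the Type-I half of W1 needs null sheets on a set of times whose
closure has POSITIVE measure («persistent sheets»; under the classical space–time analyticity of bounded mild solutions — NOT used here —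
the sheet-time set is locally a finite union of points and intervals, so this means an INTERVAL of sheet times).

MECHANISM (why a.e. in time suffices although the landed chain is pointwise in time).  The landed chain is
hinge (a) ⟶ (L) one-sided law ⟶ (S⁺) window decay ⟶ Liouville.  (L) (`NetFlux.OneSidedNetFluxLaw`, conjunct 4) is a backward-difference
inequality AT EACH time `t`, derived from slice data at time `t` only (`oneSidedLaw_core`, p-ids in `…OneSidedLaw.lean`); so off `D` it
survives verbatim (AE-1, with hinge (a) localised to open time intervals by time-translation of the landed K2, AE-0).  (S⁺) feeds (L) into the
half-line Ornstein–Uhlenbeck VISCOSITY comparison `HalfLineOU.halfLineOU_decay_viscosity` (Literature, proved), which wants the viscosity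
inequality at EVERY interior touching point `(s₀, ρ₀)` of the self-similar cumulative flux `U(s,ρ) = ∫₀^{ρe^{-s/2}} netFlux(T(−e^{−s}), r) dr`.
The lever (v1.1, after critic V19) is AE-2′ `HalfLineOUDecayOffNull`: the LANDED comparison's conclusion (exponential decay in the cubic
growth class) under its viscosity hypothesis assumed only at touching points with `s₀ ∉ D'`, `D'` Lebesgue-null, for subsolutions that are
(α) locally Lipschitz in `s` uniformly in `ρ` (AE-3: true for our `U` — near the centre by the landed `NetFlux.nearCentreFlux`, away from it
by smoothness of `T` off `x₀`) and (β) `C¹` in `ρ` on `(0,∞)` with a locally Lipschitz derivative, locally uniformly in `s` (AE-3b: `U_ρ =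
e^{−s/2} w`, `w(t,·) = netFlux` locally Lipschitz on `[a,R]` — the oscillation of a smooth function over spheres).  PROOF ROUTE (paper, checked
against V19): (1) at every `(σ,ρ)` with `σ ∉ D'`, `U(·,ρ)` differentiable at `σ` and `U_ρ(σ,·)` differentiable at `ρ` — a set of FULL plane
measure by (α), (β), Rademacher on lines and Fubini — the cross test `φ := [r-slice] 2nd-order Taylor polynomial of U(σ,·) at ρ + δ(r−ρ)² |
[σ-line] U(·,ρ) | [else] U + 1` is admissible, so the hypothesis gives the POINTWISE a.e. inequality `∂ₛU ≤ ∂ρU_ρ + (C − ρ/2)U_ρ`; (2) the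
operator has `s`-INDEPENDENT coefficients, so the one-sided `s`-mollification `U^ε = U ∗ₛ η_ε` (`supp η_ε ⊂ [0,ε]`) is `C¹` in `s`, keeps
(β), and satisfies the same a.e. inequality (differentiate under the integral; Fubini); (3) `U^ε` satisfies the CROSS-class touching inequality
at EVERY point `s₀ > s₁ + ε`: on the line `φₛ = ∂ₛU^ε(s₀,ρ₀)` (both differentiable), on the slice `φ₁(ρ₀) = U^ε_ρ(s₀,ρ₀)` and, integrating the
a.e. inequality twice from `ρ₀` (its right side `∂ₛU^ε − (C−ρ/2)U^ε_ρ` is CONTINUOUS in `ρ`) against the Peano expansion of `φ(s₀,·)`,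
`φ₂(ρ₀) ≥ ∂ₛU^ε(s₀,ρ₀) − (C − ρ₀/2)U^ε_ρ(s₀,ρ₀)`; (4) the landed `HalfLineOU.halfLineOU_decay_viscosity` applied to `U^ε` on `[s₁+ε,∞)` BY NAME
(continuity, `U^ε(s,0) ≤ 0`, growth `c(1+ρ)³` pass to averages) gives `U^ε ≤ A c (1+ρ)³ e^{−λ(s−s₁−ε)}` with the comparison's own `λ, A`;
(5) `ε → 0`.  No closedness of `D'` is needed in AE-2′ (any null set of exceptional times is removable in this regularity class); closedness
of `D` is kept upstream because hinge (a) (AE-0) lives on open time intervals.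
V19 RECORD (critic ns-wall-crit-1 g3, 2026-08-29T01:25Z): the v1.0 lever `ViscRemovableNullTimes` — «the cross-class touching inequality
itself extends across a closed null set of times for `s`-Lipschitz `U`» — is FALSE AS TYPED: `U(s,ρ) = −(ρ−2)² + 2.98(1−s) −
(1−s)e^{−(ρ−2)²/(4(1−s))}` (`s<1`), `−(ρ−2)² − 2(s−1)` (`s ≥ 1`), `C = 1`, `D = {1}`, touching point `(1,2)`: the comparison's test class
is a CROSS class (φ constrained only on `{s=s₀} ∪ {ρ=ρ₀}`), so at an exceptional time the `s`-superdifferential along the line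
(`p = −1.98`) and the `ρ`-jet along the slice (`X = −2`) DECOUPLE (`−1.98 ≤ −2` fails) — the v1.0 barrier proof presupposed a joint
superjet.  The Prop is kept below, marked REFUTED, with no stub.  AE-2′ never asserts a touching inequality at an exceptional time: it
asserts the DECAY, and the exceptional slices disappear under `s`-mollification.  (The critic's `U` satisfies every hypothesis of AE-2′
and, being a genuine a.e. subsolution, its conclusion.)  Null is still sharp for (1): `U(s) = ∫₀^s 𝟙_E`, `E` fat closed, is Lipschitz and
satisfies `∂ₛU ≤ 0` exactly off `E`.

HONEST LABEL.  A crux-idea sketch on W1; nothing here is an NS-regularity statement; ⟨1222⟩ `PoloidalLiouville`, C⁻, the wall stub and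
K3ᵃᵉ itself are OPEN; Navier–Stokes regularity is NOT proved.  The Props `sphCrit`, `StratumPred`, `analyticFinitePred`,
`ScalarLiouvilleTypeIOn`, `NetFluxWindowDecayOn`, `DenseFiniteZeroScalarLiouvilleTypeI`, `NullSheetResidualTypeI`, `NSSpatialAnalyticity` are
VERBATIM copies of the LINE's (§A/§B of `Lines/height_head.lean`, namespace `…HeightHead`) — copied only because Cruxes modules are not
importable on the check lane; they are definitionally equal to the line's.
-/

noncomputable section

open Set Function Filter Topology MeasureTheory
open scoped RealInnerProductSpace

set_option linter.dupNamespace false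

namespace Summit.NavierStokesRegularity.NavierStokesRegularity.Cruxes.PoloidalLiouville.NullTime

open Summit.NavierStokesRegularity.NavierStokesRegularity.Cruxes.PoloidalLiouville
open Summit.NavierStokesRegularity.NavierStokesRegularity.Cruxes.PoloidalLiouville.NetFlux
open Summit.NavierStokesRegularity.NavierStokesRegularity.Theorems.PoloidalLiouville (NetFlux.sphArgmax
  NetFlux.sphArgmin NetFlux.radDeriv)
open Summit.NavierStokesRegularity.NavierStokesRegularity.Theorems.PoloidalLiouville.NetFlux (sphArgmax sphArgmin
  radDeriv)
open Literature.Analysis.FluidPDE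

/-! ### §0 Verbatim prerequisites (copies of the LINE's objects) -/

/-- Sphere-critical set of `f|_{S_r(x₀)}` = vorticity zeros on the sphere when `ω = ∇f × (x − x₀)` (copy of `HeightHead.sphCrit`). -/
def sphCrit (f : E3 → ℝ) (x₀ : E3) (r : ℝ) : Set E3 :=
  {x : E3 | x ∈ Metric.sphere x₀ r ∧ cross (gradient f x) (x - x₀) = 0}

abbrev StratumPred : Type := (ℝ → E3 → E3) → E3 → (ℝ → E3 → ℝ) → ℝ → Prop

/-- The height-head stratum at time `t` (copy of `HeightHead.analyticFinitePred`). -/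
abbrev analyticFinitePred : StratumPred := fun v x₀ T t =>
  AnalyticOnNhd ℝ (v t) (univ : Set E3) ∧ AnalyticOnNhd ℝ (T t) ({x₀}ᶜ : Set E3) ∧
    Ioi (0 : ℝ) ⊆ closure {r : ℝ | 0 < r ∧ (sphCrit (T t) x₀ r).Finite}

/-- (S⁺) on the stratum `S` (copy of `HeightHead.NetFluxWindowDecayOn`). -/
def NetFluxWindowDecayOn (S : StratumPred) : Prop :=
  ∀ C : ℝ, 0 ≤ C → ∃ lam > (0 : ℝ), ∃ A : ℝ,
    ∀ (v : ℝ → E3 → E3) (x₀ : E3) (T : ℝ → E3 → ℝ) (C₁ t₀ : ℝ), t₀ < 0 →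
    ContDiffOn ℝ (⊤ : ℕ∞) (uncurry v) (Ioo t₀ 0 ×ˢ univ) →
    ContDiffOn ℝ (⊤ : ℕ∞) (uncurry T) (Ioo t₀ 0 ×ˢ ({x₀}ᶜ : Set E3)) →
    (∀ t ∈ Ioo t₀ 0, ∀ x, ‖v t x‖ ≤ C / Real.sqrt (-t)) →
    (∀ t ∈ Ioo t₀ 0, ∀ x, ‖curl (v t) x‖ ≤ C₁ / (-t)) →
    (∀ t ∈ Ioo t₀ 0, ∀ x, curl (v t) x = cross (gradient (T t) x) (x - x₀)) →
    CurledLaw v x₀ T (Ioo t₀ 0) →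
    (∀ t ∈ Ioo t₀ 0, S v x₀ T t) →
    ∀ t₁ t R : ℝ, t₀ < t₁ → t₁ ≤ t → t < 0 → 0 < R →
      ∫ r in Ioo 0 R, netFlux (T t) x₀ r
        ≤ A * C₁ * (1 + R / Real.sqrt (-t)) ^ 3 * (t / t₁) ^ lam

/-- The Type-I scalar Liouville statement on the stratum `S` (copy of `HeightHead.ScalarLiouvilleTypeIOn`). -/
def ScalarLiouvilleTypeIOn (S : StratumPred) : Prop :=
  ∀ (v : ℝ → E3 → E3) (x₀ : E3) (T : ℝ → E3 → ℝ),
    (∃ C : ℝ, HasTypeITimeDecay C v) →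
    IsBoundedAncientMildSolution 1 v →
    (∀ t < 0, AEStronglyMeasurable (v t) volume) →
    ContDiffOn ℝ (⊤ : ℕ∞) (uncurry v) (Iio 0 ×ˢ univ) →
    ContDiffOn ℝ (⊤ : ℕ∞) (uncurry T) (Iio 0 ×ˢ ({x₀}ᶜ : Set E3)) →
    (∃ C : ℝ, ∀ t < 0, ∀ x, |T t x| ≤ C) →
    (∀ t < 0, ∀ x, curl (v t) x = cross (gradient (T t) x) (x - x₀)) →
    CurledLaw v x₀ T (Iio 0) →
    (∀ t < 0, S v x₀ T t) →
    ∀ t < 0, ∀ x, cross (gradient (T t) x) (x - x₀) = 0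

/-- K3ᶠ (copy of `HeightHead.DenseFiniteZeroScalarLiouvilleTypeI`). -/
def DenseFiniteZeroScalarLiouvilleTypeI : Prop :=
  ∀ (v : ℝ → E3 → E3) (x₀ : E3) (T : ℝ → E3 → ℝ),
    (∃ C : ℝ, HasTypeITimeDecay C v) →
    IsBoundedAncientMildSolution 1 v →
    (∀ t < 0, AEStronglyMeasurable (v t) volume) →
    ContDiffOn ℝ (⊤ : ℕ∞) (uncurry v) (Iio 0 ×ˢ univ) →
    ContDiffOn ℝ (⊤ : ℕ∞) (uncurry T) (Iio 0 ×ˢ ({x₀}ᶜ : Set E3)) →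
    (∃ C : ℝ, ∀ t < 0, ∀ x, |T t x| ≤ C) →
    (∀ t < 0, ∀ x, curl (v t) x = cross (gradient (T t) x) (x - x₀)) →
    CurledLaw v x₀ T (Iio 0) →
    (∀ t < 0, Ioi (0 : ℝ) ⊆ closure {r : ℝ | 0 < r ∧ (sphCrit (T t) x₀ r).Finite}) →
    ∀ t < 0, ∀ x, cross (gradient (T t) x) (x - x₀) = 0

/-- K3ᶠ's residual (copy of `HeightHead.NullSheetResidualTypeI`). -/
def NullSheetResidualTypeI : Prop :=
  ∀ (v : ℝ → E3 → E3) (x₀ : E3) (T : ℝ → E3 → ℝ),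
    (∃ C : ℝ, HasTypeITimeDecay C v) →
    IsBoundedAncientMildSolution 1 v →
    (∀ t < 0, AEStronglyMeasurable (v t) volume) →
    ContDiffOn ℝ (⊤ : ℕ∞) (uncurry v) (Iio 0 ×ˢ univ) →
    ContDiffOn ℝ (⊤ : ℕ∞) (uncurry T) (Iio 0 ×ˢ ({x₀}ᶜ : Set E3)) →
    (∃ C : ℝ, ∀ t < 0, ∀ x, |T t x| ≤ C) →
    (∀ t < 0, ∀ x, curl (v t) x = cross (gradient (T t) x) (x - x₀)) →
    CurledLaw v x₀ T (Iio 0) →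
    (∃ t < 0, ∃ a b : ℝ, 0 < a ∧ a < b ∧ ∀ r ∈ Ioo a b, (sphCrit (T t) x₀ r).Infinite) →
    (∃ t < 0, ∃ r > 0, ¬ IsUnimodalSphere (T t) x₀ r) →
    ∀ t < 0, ∀ x, cross (gradient (T t) x) (x - x₀) = 0

/-- HH-0 (copy of `HeightHead.NSSpatialAnalyticity`; LANDED p682567 `NetFlux.nsSpatialAnalyticity`). -/
def NSSpatialAnalyticity : Prop :=
  ∀ v : ℝ → E3 → E3, IsBoundedAncientMildSolution 1 v → (∀ t < 0, AEStronglyMeasurable (v t) volume) →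
    ContDiffOn ℝ (⊤ : ℕ∞) (Function.uncurry v) (Iio 0 ×ˢ univ) →
    ∀ t < 0, AnalyticOnNhd ℝ (v t) (univ : Set E3)

/-- Guard: HH-0 is closed by name (the copy is the landed type). -/
theorem hh0 : NSSpatialAnalyticity := Theorems.PoloidalLiouville.NetFlux.nsSpatialAnalyticity

/-! ### §1 The a.e.-time stratum and the new statements -/

/-- The height-head stratum demanded only OFF the exceptional time set `D`. -/
abbrev offNullPred (D : Set ℝ) : StratumPred := fun v x₀ T t => t ∉ D → analyticFinitePred v x₀ T t

/-- **K3ᵃᵉ, analytic-stratum form**: for every closed Lebesgue-null set of times `D`, Type-I scalar Liouville on the stratum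
«height-head condition at every `t < 0` outside `D`». -/
def NullTimeAnalyticScalarLiouvilleTypeI : Prop :=
  ∀ D : Set ℝ, IsClosed D → volume D = 0 → ScalarLiouvilleTypeIOn (offNullPred D)

/-- **K3ᵃᵉ `NullTimeDenseFiniteZeroScalarLiouvilleTypeI` — the STRENGTHENING of K3ᶠ typed by this sketch.**  Same binders as K3ᶠ;
hypothesis 9 weakened from «dense finite-zero radii at every `t < 0`» to «… at every `t < 0` outside a closed null set of times». -/
def NullTimeDenseFiniteZeroScalarLiouvilleTypeI : Prop :=
  ∀ (v : ℝ → E3 → E3) (x₀ : E3) (T : ℝ → E3 → ℝ),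
    (∃ C : ℝ, HasTypeITimeDecay C v) →
    IsBoundedAncientMildSolution 1 v →
    (∀ t < 0, AEStronglyMeasurable (v t) volume) →
    ContDiffOn ℝ (⊤ : ℕ∞) (uncurry v) (Iio 0 ×ˢ univ) →
    ContDiffOn ℝ (⊤ : ℕ∞) (uncurry T) (Iio 0 ×ˢ ({x₀}ᶜ : Set E3)) →
    (∃ C : ℝ, ∀ t < 0, ∀ x, |T t x| ≤ C) →
    (∀ t < 0, ∀ x, curl (v t) x = cross (gradient (T t) x) (x - x₀)) →
    CurledLaw v x₀ T (Iio 0) →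
    (∃ D : Set ℝ, IsClosed D ∧ volume D = 0 ∧
      ∀ t < 0, t ∉ D → Ioi (0 : ℝ) ⊆ closure {r : ℝ | 0 < r ∧ (sphCrit (T t) x₀ r).Finite}) →
    ∀ t < 0, ∀ x, cross (gradient (T t) x) (x - x₀) = 0

/-- **`PersistentSheetResidualTypeI` — the residual after K3ᵃᵉ**: the sheet times cannot be covered by a closed null set (equivalently:
the closure in `(-∞,0)` of the set of times carrying an interval of infinite-zero radii has positive measure), AND some sphere at some time
is not unimodal.  OPEN (wall-class; the axisymmetric no-swirl model is KNSS 2009). -/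
def PersistentSheetResidualTypeI : Prop :=
  ∀ (v : ℝ → E3 → E3) (x₀ : E3) (T : ℝ → E3 → ℝ),
    (∃ C : ℝ, HasTypeITimeDecay C v) →
    IsBoundedAncientMildSolution 1 v →
    (∀ t < 0, AEStronglyMeasurable (v t) volume) →
    ContDiffOn ℝ (⊤ : ℕ∞) (uncurry v) (Iio 0 ×ˢ univ) →
    ContDiffOn ℝ (⊤ : ℕ∞) (uncurry T) (Iio 0 ×ˢ ({x₀}ᶜ : Set E3)) →
    (∃ C : ℝ, ∀ t < 0, ∀ x, |T t x| ≤ C) →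
    (∀ t < 0, ∀ x, curl (v t) x = cross (gradient (T t) x) (x - x₀)) →
    CurledLaw v x₀ T (Iio 0) →
    (∀ D : Set ℝ, IsClosed D → volume D = 0 →
      ∃ t < 0, t ∉ D ∧ ∃ a b : ℝ, 0 < a ∧ a < b ∧ ∀ r ∈ Ioo a b, (sphCrit (T t) x₀ r).Infinite) →
    (∃ t < 0, ∃ r > 0, ¬ IsUnimodalSphere (T t) x₀ r) →
    ∀ t < 0, ∀ x, cross (gradient (T t) x) (x - x₀) = 0

/-! ### §2 Registered stubs of the a.e.-time chain -/

/-- **AE-0 (S): hinge (a) on an open time INTERVAL** — the landed K2 `NetFlux.NF1a.extremalHeadEMF_of_levelLip` (p680049) is stated on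
windows `Ioo t₀ 0`; its hypotheses are window-local (no equation, no ancientness), so time-translation `t ↦ t − β` moves it to any `Ioo α β`. -/
def ExtremalHeadEMFOfLevelLipIoo : Prop :=
  ∀ (v : ℝ → E3 → E3) (x₀ : E3) (T P : ℝ → E3 → ℝ) (V : ℝ → ℝ) (α β : ℝ),
    ContDiffOn ℝ (⊤ : ℕ∞) (uncurry v) (Ioo α β ×ˢ univ) →
    ContDiffOn ℝ (⊤ : ℕ∞) (uncurry T) (Ioo α β ×ˢ ({x₀}ᶜ : Set E3)) →
    (∀ t ∈ Ioo α β, ContDiffOn ℝ 1 (P t) ({x₀}ᶜ : Set E3)) →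
    (∀ t ∈ Ioo α β, ∀ x, ‖v t x‖ ≤ V t) →
    (∀ t ∈ Ioo α β, ∀ x, x ≠ x₀ →
        cross (gradient (P t) x - (inner ℝ (v t x) (x - x₀)) • gradient (T t) x) (x - x₀) = 0) →
    (∀ t ∈ Ioo α β, ∀ r > 0, ∀ x ∈ Metric.sphere x₀ r, ∀ y ∈ Metric.sphere x₀ r,
        |P t x - P t y| ≤ (r * V t) * |T t x - T t y|) →
    ∃ I : ℝ → ℝ → ℝ,
      (∀ t ∈ Ioo α β, ∀ r > 0, ∀ xp ∈ sphArgmax (T t) x₀ r, ∀ xm ∈ sphArgmin (T t) x₀ r,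
          I t r = P t xp - P t xm) ∧
      ContinuousOn (uncurry I) (Ioo α β ×ˢ Ioi 0) ∧
      (∀ t ∈ Ioo α β, ∀ a b : ℝ, 0 < a → a < b → ∃ L : NNReal, LipschitzOnWith L (I t) (Icc a b)) ∧
      (∀ t ∈ Ioo α β, ∀ r > 0, |I t r| ≤ V t * netFlux (T t) x₀ r) ∧
      (∀ t ∈ Ioo α β, ∀ᵐ r : ℝ, 0 < r →
          deriv (I t) r ≤ sSup (radDeriv (P t) x₀ '' sphArgmax (T t) x₀ r)
                          - sInf (radDeriv (P t) x₀ '' sphArgmin (T t) x₀ r))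

theorem stub_extremalHeadEMFOfLevelLipIoo : ExtremalHeadEMFOfLevelLipIoo :=
  Theorems.PoloidalLiouville.NetFlux.NF1a.extremalHeadEMF_of_levelLip_Ioo  -- CLOSED BY NAME: p685855 (ns-qj-p1 g5)

/-- **AE-1 (S): the one-sided law OFF a closed exceptional time set.**  Conjuncts 1–3 of `NetFlux.OneSidedNetFluxLaw` (envelope facts,
stratum-free) on the whole window; conjunct 4 (the backward-difference inequality) at every window time OUTSIDE `D`.  Proof = the landed
`oneSidedNetFluxLawOn_of_extremalHeadEMFOn` (p678535) run per time: at `t ∉ D` take the component interval of `(t₀,0) ∖ D` (open, `D` closed),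
K1⁺ `levelLipschitz_of_analytic_finiteCrit` (p679110) + the closure lemma give the slice level-Lipschitz property there, AE-0 gives `I`, and
`oneSidedLaw_core` is pointwise in `t`. -/
def OneSidedLawOffNull : Prop :=
  ∀ (D : Set ℝ), IsClosed D → ∀ (v : ℝ → E3 → E3) (x₀ : E3) (T : ℝ → E3 → ℝ) (V : ℝ → ℝ) (t₀ : ℝ),
    ContDiffOn ℝ (⊤ : ℕ∞) (uncurry v) (Ioo t₀ 0 ×ˢ univ) →
    ContDiffOn ℝ (⊤ : ℕ∞) (uncurry T) (Ioo t₀ 0 ×ˢ ({x₀}ᶜ : Set E3)) →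
    (∀ t ∈ Ioo t₀ 0, ∀ x, ‖v t x‖ ≤ V t) →
    CurledLaw v x₀ T (Ioo t₀ 0) →
    (∀ t ∈ Ioo t₀ 0, t ∉ D → analyticFinitePred v x₀ T t) →
    ∃ ℓp ℓm : ℝ → ℝ → ℝ,
      ContinuousOn (fun p : ℝ × ℝ => netFlux (T p.1) x₀ p.2) (Ioo t₀ 0 ×ˢ Ioi 0) ∧
      (∀ t ∈ Ioo t₀ 0, ∀ r > 0, HasDerivWithinAt (fun ρ => netFlux (T t) x₀ ρ) (ℓp t r) (Ioi r) r) ∧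
      (∀ t ∈ Ioo t₀ 0, ∀ r > 0, HasDerivWithinAt (fun ρ => netFlux (T t) x₀ ρ) (ℓm t r) (Iio r) r) ∧
      (∀ t ∈ Ioo t₀ 0, t ∉ D → ∀ a R : ℝ, 0 < a → a < R → ∀ ε > 0, ∃ δ > 0, ∀ h ∈ Ioo 0 δ,
          (∫ r in Ioo a R, netFlux (T t) x₀ r) - (∫ r in Ioo a R, netFlux (T (t - h)) x₀ r)
            ≤ h * (ℓp t R - ℓm t a + V t * (netFlux (T t) x₀ R + netFlux (T t) x₀ a) + ε))

theorem stub_oneSidedLawOffNull : OneSidedLawOffNull :=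
  Theorems.PoloidalLiouville.NetFlux.oneSidedLawOffNull  -- CLOSED BY NAME: p686638 (ns-qj-p1 g5)

/-- The viscosity-subsolution inequality of the half-line OU operator `∂_s − ∂_ρ² − (C − ρ/2)∂_ρ` for `U` at the touching points allowed
by the side condition `ok s₀` — EXACTLY the sixth hypothesis of `HalfLineOU.halfLineOU_decay_viscosity` when `ok = ⊤`. -/
def OUViscosityIneqAt (U : ℝ → ℝ → ℝ) (s₁ C : ℝ) (ok : ℝ → Prop) : Prop :=
  ∀ (φ : ℝ → ℝ → ℝ) (φₛ : ℝ) (φ₁ φ₂ : ℝ → ℝ) (s₀ ρ₀ : ℝ), s₁ < s₀ → 0 < ρ₀ → ok s₀ →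
    HasDerivAt (fun σ => φ σ ρ₀) φₛ s₀ →
    (∀ r, HasDerivAt (φ s₀) (φ₁ r) r) → (∀ r, HasDerivAt φ₁ (φ₂ r) r) →
    IsLocalMax (fun p : ℝ × ℝ => U p.1 p.2 - φ p.1 p.2) (s₀, ρ₀) →
    φₛ ≤ φ₂ ρ₀ + (C - ρ₀ / 2) * φ₁ ρ₀

/-- Guard: with no side condition this is the comparison theorem's hypothesis shape (definitional). -/
example (U : ℝ → ℝ → ℝ) (s₁ C : ℝ) (h : OUViscosityIneqAt U s₁ C (fun _ => True)) :
    ∀ (φ : ℝ → ℝ → ℝ) (φₛ : ℝ) (φ₁ φ₂ : ℝ → ℝ) (s₀ ρ₀ : ℝ), s₁ < s₀ → 0 < ρ₀ →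
      HasDerivAt (fun σ => φ σ ρ₀) φₛ s₀ →
      (∀ r, HasDerivAt (φ s₀) (φ₁ r) r) → (∀ r, HasDerivAt φ₁ (φ₂ r) r) →
      IsLocalMax (fun p : ℝ × ℝ => U p.1 p.2 - φ p.1 p.2) (s₀, ρ₀) →
      φₛ ≤ φ₂ ρ₀ + (C - ρ₀ / 2) * φ₁ ρ₀ :=
  fun φ φₛ φ₁ φ₂ s₀ ρ₀ h1 h2 => h φ φₛ φ₁ φ₂ s₀ ρ₀ h1 h2 trivial

/-- **REFUTED AS TYPED (critic V19, 2026-08-29T01:25Z) — kept for the record, NO stub.**  v1.0's lever: «closed null sets of times are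
removable for the CROSS-class touching inequality of `s`-Lipschitz subsolutions».  Counterexample (C = 1, s₁ = 0, D = {1}, touching point
(1,2)): `U(s,ρ) = −(ρ−2)² + 2.98(1−s) − (1−s)·exp(−(ρ−2)²/(4(1−s)))` for `s < 1`, `−(ρ−2)² − 2(s−1)` for `s ≥ 1` — continuous, `s`-Lipschitz,
a classical strict subsolution off `{s = 1}`, and the cross test `φ = [s=1] −(ρ−2)² | [ρ=2] −1.98(s−1) | [else] U+1` at (1,2) yields
`−1.98 ≤ −2`, false.  Mechanism: at an exceptional time the line-superdifferential and the slice-jet decouple in the cross class. -/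
def ViscRemovableNullTimes : Prop :=
  ∀ (U : ℝ → ℝ → ℝ) (s₁ C : ℝ) (D : Set ℝ), IsClosed D → volume D = 0 →
    ContinuousOn (uncurry U) (Ici s₁ ×ˢ Ici 0) →
    (∀ a b R : ℝ, s₁ < a → a < b → 0 < R →
      ∃ L : NNReal, ∀ ρ ∈ Icc 0 R, LipschitzOnWith L (fun s => U s ρ) (Icc a b)) →
    OUViscosityIneqAt U s₁ C (fun s => s ∉ D) →
    OUViscosityIneqAt U s₁ C (fun _ => True)

/-- **AE-2′ (the LEVER, v1.2 form — pure real analysis; LANDED p687414): half-line OU decay with a REMOVABLE CLOSED NULL SET OF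
EXCEPTIONAL TIMES for subsolutions that are Lipschitz in `s` on compacts.**  Exactly `HalfLineOU.halfLineOU_decay_viscosity` (same
`∀ C, ∃ λ A` prefix, same conclusion) with (i) `D ⊆ ℝ` closed and Lebesgue-null, (ii) `s`-Lipschitz bounds on `[a,b] × [0,R]` (`s₁ < a`; the
shape of AE-3), (iii) the cross-class viscosity hypothesis only at touching points `s₀ ∉ D`.  = v1.1 `HalfLineOUDecayOffNull` with `IsClosed D →`
inserted and the `U₁` clause deleted (ARM A g5).  Proof (landed): the tree comparison proof run with the test function `Ψ + G`, `G` the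
null-time barrier `NetFlux.exists_nullTimeBarrier` (p686271): `G' = Nψ ≥ 0` keeps `Ψ + G` a strict supersolution, `0 ≤ G ≤ κ → 0`, and the slope
`N = L + M_d + 1` just left of `D` forces the interior maximiser's time off `D`.  Closedness IS load-bearing (critic 01:54Z); it is available
downstream (K3ᵃᵉ / AE-4′ quantify closed `D`). -/
def HalfLineOUDecayOffNullClosed : Prop :=
  ∀ C : ℝ, 0 ≤ C → ∃ lam > 0, ∃ A : ℝ, ∀ (U : ℝ → ℝ → ℝ) (s₁ c : ℝ) (D : Set ℝ), IsClosed D → volume D = 0 →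
    ContinuousOn (uncurry U) (Ici s₁ ×ˢ Ici 0) →
    (∀ s, s₁ ≤ s → U s 0 ≤ 0) →
    (∀ s, s₁ ≤ s → ∀ ρ, 0 ≤ ρ → U s ρ ≤ c * (1 + ρ) ^ 3) →
    0 ≤ c →
    (∀ a b R : ℝ, s₁ < a → a < b → 0 < R →
      ∃ L : NNReal, ∀ ρ ∈ Icc 0 R, LipschitzOnWith L (fun s => U s ρ) (Icc a b)) →
    OUViscosityIneqAt U s₁ C (fun s => s ∉ D) →
    ∀ s, s₁ ≤ s → ∀ ρ, 0 ≤ ρ → U s ρ ≤ A * c * (1 + ρ) ^ 3 * Real.exp (-lam * (s - s₁))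

theorem stub_halfLineOUDecayOffNullClosed : HalfLineOUDecayOffNullClosed :=
  Theorems.PoloidalLiouville.NetFlux.halfLineOU_decay_viscosity_offNull  -- CLOSED BY NAME: p687414 (ARM A g5)

/-- ASIDE (v1.1 form of AE-2′, NOT on the registered chain since v1.2, no stub): the same decay with `D` merely Lebesgue-null (not closed) for
subsolutions that are `s`-Lipschitz AND `C¹` in `ρ` with locally Lipschitz derivative (clause (iii)).  Plausibly true by the v1.1 route (a.e.
pointwise inequality from cross tests at differentiability points ⟶ one-sided `s`-mollification ⟶ cross-class inequality for `U^ε` everywhere ⟶ the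
landed comparison BY NAME ⟶ `ε → 0`); kept because it records that closedness is needed only by the barrier proof, not by the phenomenon. -/
def HalfLineOUDecayOffNull : Prop :=
  ∀ C : ℝ, 0 ≤ C → ∃ lam > 0, ∃ A : ℝ, ∀ (U : ℝ → ℝ → ℝ) (s₁ c : ℝ) (D : Set ℝ), volume D = 0 →
    ContinuousOn (uncurry U) (Ici s₁ ×ˢ Ici 0) →
    (∀ s, s₁ ≤ s → U s 0 ≤ 0) →
    (∀ s, s₁ ≤ s → ∀ ρ, 0 ≤ ρ → U s ρ ≤ c * (1 + ρ) ^ 3) →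
    0 ≤ c →
    (∀ a b R : ℝ, s₁ < a → a < b → 0 < R →
      ∃ L : NNReal, ∀ ρ ∈ Icc 0 R, LipschitzOnWith L (fun s => U s ρ) (Icc a b)) →
    (∃ U₁ : ℝ → ℝ → ℝ, (∀ s, s₁ < s → ∀ ρ, 0 < ρ → HasDerivAt (U s) (U₁ s ρ) ρ) ∧
      ∀ a b r R : ℝ, s₁ < a → a < b → 0 < r → r < R →
        ∃ L : NNReal, ∀ s ∈ Icc a b, LipschitzOnWith L (U₁ s) (Icc r R)) →
    OUViscosityIneqAt U s₁ C (fun s => s ∉ D) →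
    ∀ s, s₁ ≤ s → ∀ ρ, 0 ≤ ρ → U s ρ ≤ A * c * (1 + ρ) ^ 3 * Real.exp (-lam * (s - s₁))

/-- Guard (kernel): with `D = ∅`-type side condition `ok = ⊤` and the regularity hypotheses discarded, AE-2′ is implied by the landed
comparison — i.e. AE-2′ is a genuine STRENGTHENING of `HalfLineOU.halfLineOU_decay_viscosity`, binder-for-binder. -/
theorem halfLineOUDecayOffNull_of_top :
    ∀ C : ℝ, 0 ≤ C → ∃ lam > 0, ∃ A : ℝ, ∀ (U : ℝ → ℝ → ℝ) (s₁ c : ℝ),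
      ContinuousOn (uncurry U) (Ici s₁ ×ˢ Ici 0) →
      (∀ s, s₁ ≤ s → U s 0 ≤ 0) →
      (∀ s, s₁ ≤ s → ∀ ρ, 0 ≤ ρ → U s ρ ≤ c * (1 + ρ) ^ 3) →
      0 ≤ c →
      OUViscosityIneqAt U s₁ C (fun _ => True) →
      ∀ s, s₁ ≤ s → ∀ ρ, 0 ≤ ρ → U s ρ ≤ A * c * (1 + ρ) ^ 3 * Real.exp (-lam * (s - s₁)) := by
  intro C hC
  obtain ⟨lam, hlam, A, h⟩ := HalfLineOU.halfLineOU_decay_viscosity C hC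
  exact ⟨lam, hlam, A, fun U s₁ c h1 h2 h3 h4 h5 =>
    h U s₁ c h1 h2 h3 h4 (fun φ φₛ φ₁ φ₂ s₀ ρ₀ hs hρ => h5 φ φₛ φ₁ φ₂ s₀ ρ₀ hs hρ trivial)⟩

/-- **AE-3b (S; ASIDE since v1.2 — landed p687228 but no longer consumed by AE-4′): the net flux is locally Lipschitz in the radius away from the
centre, uniformly on compact time windows** —
`netFlux(T t, r) = r · osc_{S_r(x₀)} T(t)` and `osc_{S_r} f = sup_{‖θ‖=1} f(x₀ + rθ) − inf …` is Lipschitz in `r` on `[a,R]` with constant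
`sup ‖∇T‖` over the compact shell `[t₁,t₂] × {a ≤ ‖x−x₀‖ ≤ R}` (smoothness of `T` off `x₀`).  With the landed `hasDerivAt_window_primitive`
this makes `U_ρ(s,ρ) = e^{−s/2} netFlux(T(−e^{−s}), ρe^{−s/2})` the derivative AE-2′ (iii) wants. -/
def NetFluxRhoLipschitz : Prop :=
  ∀ (x₀ : E3) (T : ℝ → E3 → ℝ) (t₀ : ℝ),
    ContDiffOn ℝ (⊤ : ℕ∞) (uncurry T) (Ioo t₀ 0 ×ˢ ({x₀}ᶜ : Set E3)) →
    ∀ t₁ t₂ a R : ℝ, t₀ < t₁ → t₁ < t₂ → t₂ < 0 → 0 < a → a < R →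
      ∃ L : NNReal, ∀ t ∈ Icc t₁ t₂, LipschitzOnWith L (fun r => netFlux (T t) x₀ r) (Icc a R)

theorem stub_netFluxRhoLipschitz : NetFluxRhoLipschitz :=
  Theorems.PoloidalLiouville.NetFlux.netFluxRhoLipschitz  -- CLOSED BY NAME: p687228 (ns-qj-p1 g5); ASIDE since v1.2

/-- **AE-3 (S): the cumulative net flux is locally Lipschitz in time, uniformly in the radius on compacts.**  Near the centre by the landed
`NetFlux.nearCentreFlux` (`|netFlux(T t', a) − netFlux(T t'', a)| ≤ κ a² |t' − t''|`, `a < a₀`), on `[a₀, R]` by `netFlux = r · osc_{S_r} T` and the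
smoothness of `T` on the compact `[t₁,t₂] × {a₀ ≤ ‖x − x₀‖ ≤ R}` off the centre. -/
def CumulativeFluxLipschitz : Prop :=
  ∀ (v : ℝ → E3 → E3) (x₀ : E3) (T : ℝ → E3 → ℝ) (t₀ : ℝ),
    ContDiffOn ℝ (⊤ : ℕ∞) (uncurry v) (Ioo t₀ 0 ×ˢ univ) →
    ContDiffOn ℝ (⊤ : ℕ∞) (uncurry T) (Ioo t₀ 0 ×ˢ ({x₀}ᶜ : Set E3)) →
    (∀ t ∈ Ioo t₀ 0, ∀ x, curl (v t) x = cross (gradient (T t) x) (x - x₀)) →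
    ∀ t₁ t₂ R : ℝ, t₀ < t₁ → t₁ < t₂ → t₂ < 0 → 0 < R →
      ∃ L : NNReal, ∀ ρ ∈ Icc 0 R,
        LipschitzOnWith L (fun t => ∫ r in Ioo 0 ρ, netFlux (T t) x₀ r) (Icc t₁ t₂)

theorem stub_cumulativeFluxLipschitz : CumulativeFluxLipschitz :=
  Theorems.PoloidalLiouville.NetFlux.cumulativeFluxLipschitz  -- CLOSED BY NAME: p686120 (ns-qj-p1 g5)

/-- **AE-4′ (S⁺, assembly-like; v1.2 typing): window decay OFF a closed null time set** — the landed proof `netFluxWindowDecayOn_of_laws` (p678535 /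
`netFluxWindowDecay_of_laws` p669139) verbatim, except that `HalfLineOU.halfLineOU_decay_viscosity` is replaced by AE-2′
`HalfLineOUDecayOffNullClosed` (p687414) with `D' = {s | −e^{−s} ∈ D}` (closed: continuous preimage; null: image of a null set under the
diffeomorphism `t ↦ −log(−t)`): its cross-class hypothesis at touching points `s₀ ∉ D'` comes from AE-1's conjunct 4 through the landed
`viscosity_inequality_window` (which invokes the law ONLY at the touching time — re-run with `hlaw` at that time); its `s`-Lipschitz hypothesis
(ii) from AE-3 (plus the moving upper limit `ρe^{−s/2}`, `netFlux` bounded on windows by NF-0).  AE-3b is no longer needed. -/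
def NetFluxWindowDecayOffNull : Prop :=
  ∀ D : Set ℝ, IsClosed D → volume D = 0 → NetFluxWindowDecayOn (offNullPred D)

theorem stub_windowDecayOffNull :
    OneSidedLawOffNull → HalfLineOUDecayOffNullClosed → CumulativeFluxLipschitz → NetFluxWindowDecayOffNull :=
  fun _ _ _ => Theorems.PoloidalLiouville.NetFlux.netFluxWindowDecayOffNull  -- CLOSED BY NAME: p688382 (ARM A g5), v1.3

/-- (v1.3) **K3ᵃᵉ BY NAME from the Theorems side**: p688761 `NetFlux.nullTimeDenseFiniteZeroScalarLiouvilleTypeI_holds`. -/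
theorem k3ae_holds : NullTimeDenseFiniteZeroScalarLiouvilleTypeI :=
  Theorems.PoloidalLiouville.NetFlux.nullTimeDenseFiniteZeroScalarLiouvilleTypeI_holds

/-- **AE-5 (free, kernel): (S⁺) off `D` ⇒ Liouville off `D`** — the landed generic HH-5 `NetFlux.scalarLiouvilleTypeIOn_of_netFluxWindowDecayOn`
(p678536) instantiated at the stratum `offNullPred D`, BY NAME. -/
theorem nullTimeAnalytic_of_decay (h : NetFluxWindowDecayOffNull) : NullTimeAnalyticScalarLiouvilleTypeI :=
  fun D hD h0 => Theorems.PoloidalLiouville.NetFlux.scalarLiouvilleTypeIOn_of_netFluxWindowDecayOn (offNullPred D) (h D hD h0)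

/-- **AE-6 (S, mechanical): gauge transfer** — the LINE's kernel assembly `HeightHead.stub_denseFiniteZero_of_analyticStratum` (HH-0 analyticity
of `v(t)`, HH-6a analytic radial gauge, HH-6b (E1)-invariance, HH-6c) run verbatim with `t ∉ D →` threaded through the stratum hypothesis. -/
theorem stub_nullTimeDenseFinite_of_analytic :
    NSSpatialAnalyticity → NullTimeAnalyticScalarLiouvilleTypeI → NullTimeDenseFiniteZeroScalarLiouvilleTypeI :=
  Theorems.PoloidalLiouville.NetFlux.nullTimeDenseFinite_of_analytic  -- CLOSED BY NAME: p687507 (ns-qj-p1 g5)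

/-- KERNEL: K3ᵃᵉ from the stubs. -/
theorem nullTimeDenseFinite_of_stubs : NullTimeDenseFiniteZeroScalarLiouvilleTypeI :=
  stub_nullTimeDenseFinite_of_analytic hh0
    (nullTimeAnalytic_of_decay
      (stub_windowDecayOffNull stub_oneSidedLawOffNull stub_halfLineOUDecayOffNullClosed stub_cumulativeFluxLipschitz))

/-! ### §3 Kernel-checked glue: where K3ᵃᵉ sits -/

/-- K3ᵃᵉ is STRONGER than K3ᶠ (take `D = ∅`). -/
theorem denseFinite_of_nullTime (h : NullTimeDenseFiniteZeroScalarLiouvilleTypeI) : DenseFiniteZeroScalarLiouvilleTypeI :=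
  fun v x₀ T hC hB hm hsv hsT hTb hrep hE hd =>
    h v x₀ T hC hB hm hsv hsT hTb hrep hE
      ⟨∅, isClosed_empty, measure_empty, fun t ht _ => hd t ht⟩

/-- After K3ᵃᵉ only PERSISTENT sheets remain: K3ᵃᵉ ∧ `PersistentSheetResidualTypeI` ⇒ K3ᶠ's residual `NullSheetResidualTypeI`
(hence, with the LINE's `wallTypeI_of_denseFinite_sharp` and the landed unimodal rung, g0's Type-I wall half). -/
theorem nullSheetResidual_of_nullTime (h₁ : NullTimeDenseFiniteZeroScalarLiouvilleTypeI)
    (h₂ : PersistentSheetResidualTypeI) : NullSheetResidualTypeI := by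
  intro v x₀ T hC hB hm hsv hsT hTb hrep hE _ hnu
  by_cases hd : ∃ D : Set ℝ, IsClosed D ∧ volume D = 0 ∧
      ∀ t < 0, t ∉ D → Ioi (0 : ℝ) ⊆ closure {r : ℝ | 0 < r ∧ (sphCrit (T t) x₀ r).Finite}
  · exact h₁ v x₀ T hC hB hm hsv hsT hTb hrep hE hd
  · refine h₂ v x₀ T hC hB hm hsv hsT hTb hrep hE (fun D hDc hD0 => ?_) hnu
    push Not at hd
    obtain ⟨t, ht, htD, hnot⟩ := hd D hDc hD0
    refine ⟨t, ht, htD, ?_⟩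
    -- non-density of the good radii yields an interval of bad radii
    simp only [Set.not_subset] at hnot
    obtain ⟨r₀, hr₀, hcl⟩ := hnot
    rw [Metric.mem_closure_iff] at hcl
    push Not at hcl
    obtain ⟨ε, hε, hfar⟩ := hcl
    refine ⟨r₀, r₀ + ε, hr₀, by linarith, fun r hr hfin => ?_⟩
    have hr0 : 0 < r := lt_trans hr₀ hr.1
    have := hfar r ⟨hr0, hfin⟩
    rw [Real.dist_eq, abs_of_nonpos (by linarith [hr.1])] at this
    linarith [hr.2]

/-- Conversely the persistent residual is WEAKER than K3ᶠ's residual (its hypothesis is stronger). -/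
theorem persistent_of_nullSheetResidual (h : NullSheetResidualTypeI) : PersistentSheetResidualTypeI :=
  fun v x₀ T hC hB hm hsv hsT hTb hrep hE hP hnu => by
    obtain ⟨t, ht, _, a, b, ha, hab, hbad⟩ := hP ∅ isClosed_empty measure_empty
    exact h v x₀ T hC hB hm hsv hsT hTb hrep hE ⟨t, ht, a, b, ha, hab, hbad⟩ hnu

end Summit.NavierStokesRegularity.NavierStokesRegularity.Cruxes.PoloidalLiouville.NullTime

end
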